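import Summits.MatrixMultiplication.MatrixMultiplication.Theorems.AbelianSTPPCensusTAStatFSplit

/-!
# T_A static certificate, range `6780 … 6833` (multi-parameter k-member tree at `τ = 2371/1000`): kernel pieces of the cells `(12, 17, 20)`, `(15, 16, 17)` (volume `4080`) at the orders `6825 … 6827`, part 3/4

Cell mm-stpp (rung F-M1), tier T_A = «beat `2.371`, the record exponent (ADVXXZ'25 / DEK+26 rounded)»; seat mm-stpp-vp-p2 (gen 7).  Root-split layout (`AbelianSTPPCensusTAStatKMemberXSplit.lean`, `…XWalk.lean`, `AbelianSTPPCensusTAStatFSplit.lean`): the (cell, order) tree(s) have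
579807 nodes — beyond one `decide` — and is cut along list positions into `goIR` pieces / small subtrees / descent children of ≤ 4·10⁴ nodes each
(this file: 6 pieces, 156469 nodes; sizes from the exact twin seat twin/tastat9.py, kit j314549), assembled in `AbelianSTPPCensusTAStatFCkS4080o6825t6827.lean`.
`decide` with kernel reduction (standard axioms; no `native_decide`), `Elab.async false`.
WHAT THIS IS NOT: arithmetic on shape lists only; no statement about STPP families or `ω`.
-/

set_option linter.dupNamespace false
set_option autoImplicit false
set_option Elab.async false

namespace Summit.MatrixMultiplication.MatrixMultiplication.Theorems.TAStatF

open ShapeCert (gainOf2371j)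
open TECert (vol)

set_option maxHeartbeats 0 in
/-- root positions `8 … 165` (bucket `70`, order `6826`): 25958 nodes [original] -/
theorem s4080o6826x1b70rg2 : TAStatKM.goIR gainOf2371j 4080 (fun A' ms' => TAStatKM.treeKX tb m2l gainOf2371j (rowOf 4080) (xrowOf 4080) (gainOf2371j 4080) 767 4080 1486 15 240 6826 kmax 81 A' 70 ms') TAStatKM.agg0 (m2l 70) 8 158 = true := by decide +kernel

set_option maxHeartbeats 0 in
/-- root descent child to bucket `69` (1 nodes) [original] -/
theorem s4080o6826x1b70rd : TAStatKM.treeKX tb m2l gainOf2371j (rowOf 4080) (xrowOf 4080) (gainOf2371j 4080) 767 4080 1486 15 240 6826 kmax 81 TAStatKM.agg0 69 (m2l 69) = true := by decide +kernel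

set_option maxHeartbeats 0 in
/-- root positions `0 … 3` (bucket `70`, order `6827`): 26831 nodes [original] -/
theorem s4080o6827x0b70rg0 : TAStatKM.goIR gainOf2371j 4080 (fun A' ms' => TAStatKM.treeKX tb m2l gainOf2371j (rowOf 4080) (xrowOf 4080) (gainOf2371j 4080) 784 4080 1519 12 204 6827 kmax 81 A' 70 ms') TAStatKM.agg0 (m2l 70) 0 4 = true := by decide +kernel

set_option maxHeartbeats 0 in
/-- root positions `4 … 5` (bucket `70`, order `6827`): 38810 nodes [original] -/
theorem s4080o6827x0b70rg1 : TAStatKM.goIR gainOf2371j 4080 (fun A' ms' => TAStatKM.treeKX tb m2l gainOf2371j (rowOf 4080) (xrowOf 4080) (gainOf2371j 4080) 784 4080 1519 12 204 6827 kmax 81 A' 70 ms') TAStatKM.agg0 (m2l 70) 4 2 = true := by decide +kernel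

set_option maxHeartbeats 0 in
/-- root positions `6 … 7` (bucket `70`, order `6827`): 28346 nodes [original] -/
theorem s4080o6827x0b70rg2 : TAStatKM.goIR gainOf2371j 4080 (fun A' ms' => TAStatKM.treeKX tb m2l gainOf2371j (rowOf 4080) (xrowOf 4080) (gainOf2371j 4080) 784 4080 1519 12 204 6827 kmax 81 A' 70 ms') TAStatKM.agg0 (m2l 70) 6 2 = true := by decide +kernel

set_option maxHeartbeats 0 in
/-- root positions `8 … 165` (bucket `70`, order `6827`): 36523 nodes [original] -/
theorem s4080o6827x0b70rg3 : TAStatKM.goIR gainOf2371j 4080 (fun A' ms' => TAStatKM.treeKX tb m2l gainOf2371j (rowOf 4080) (xrowOf 4080) (gainOf2371j 4080) 784 4080 1519 12 204 6827 kmax 81 A' 70 ms') TAStatKM.agg0 (m2l 70) 8 158 = true := by decide +kernel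

end Summit.MatrixMultiplication.MatrixMultiplication.Theorems.TAStatF
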